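import Literature.NumberTheory.EllipticCurves.SkinnerUrban2014.CharacteristicIdealBaseChangeProofs
import Literature.NumberTheory.EllipticCurves.IwasawaAlgebraRankOneIdealProofs
import Literature.NumberTheory.EllipticCurves.IwasawaAlgebraStructureProofs
import Literature.NumberTheory.EllipticCurves.IwasawaAlgebraCharIdealProofs
import Literature.NumberTheory.EllipticCurves.IwasawaAlgebraProofs
import Literature.NumberTheory.EllipticCurves.IwasawaAlgebra
import Mathlib.RingTheory.PowerSeries.WeierstrassPreparation
import Mathlib.RingTheory.Polynomial.Eisenstein.Distinguished
import HarnessLib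

/-!
# Characteristic ideals up to constants determine the height-one lengths off `ϖ`; over `Λ = A⟦X⟧`
# (`A` a DVR) pseudo-null modules are `ϖ`-power torsion and pseudo-isomorphisms preserve `dim_K(K ⊗_A ·)`

Route `ResidualThetaTransportAtTwo` (RTT), crux RSL_g `ResidualSignedLambdaLowerCMAtTwo` (stmt-BirchSwinnertonDyer-22608):
STUB-PLAN rev 3 (`Cruxes/ResidualThetaCountLowerPureAtTwo/STUB-PLAN-stub_cmLambdaLower.md`) §3 Step 1, the `Λ_𝒪`
ALGEBRA KIT (A1 `LengthEqOffConstants` and the first half of k2-g2's H-λchar `FinrankEqOfCharIdealEqUpToConst`).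
Seat `prover-bsd-wall-rtt-p2` g15 (`--supports`, closes nothing). THEOREMS ONLY (no definition, no named fact, no
instance, no `sorry`); pure commutative algebra; nothing about curves, Selmer groups or `L`-functions; BSD is not proved
by any of this.

## Why (the one place on S2's path where characteristic IDEALS must be turned into λ-invariants)
The HOLD print input of S2 (Burungale–Tian 2026 Thm. 2.6 for the CM form `g` at `p = 2`) is typed in the currency
`Kato2004.ZetaQuotientPackage.CharIdealEqUpToConst`: `(C c)·char(𝐇²) = (C d)·char(𝐇¹/Z)` for non-zero constants
`c, d ∈ 𝒪`. The λ-bookkeeping of the line (`LambdaLowerBoundO.finrank_baseChange_eq_of_exact_of_eq` p625690,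
`cmLambdaLower_of_corank` p645378) runs in the currency `dim_K (K ⊗_𝒪 ·) = rank_𝒪(·/torsion)`. This file and its sequel
`…CharIdealLambda` supply the bridge.

## What
* §1 (any Noetherian UFD `R`): **`lengthAt_eq_of_span_singleton_mul_charIdeal_eq`** — for finitely generated torsion
  `M, N` and non-zero `c, d`, `(c)·char(M) = (d)·char(N)` forces `ℓ_𝔭(M) = ℓ_𝔭(N)` at every height-one prime
  `𝔭 ∌ c, d` (trick: `(c)·char(M) = char(M × R/(c))`, then the tree's `SkinnerUrban2014.lengthAt_eq_of_charIdeal_eq` and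
  `ℓ_𝔭(R/(c)) = 0`); one-sided version `lengthAt_le_of_span_singleton_mul_charIdeal_le`.
* §2 (`Λ = A⟦X⟧`, `A` a DVR with uniformiser `ϖ`): `ringKrullDim_powerSeries_eq_two`; a prime `𝔮 ∌ C ϖ` has height
  `≤ 1`; **every element of a pseudo-null `Λ`-module is killed by a power of `C ϖ`**; hence, for any `K ⊇ A` in which
  `ϖ` is invertible and flat over `A` (e.g. `K = Frac A`), **a pseudo-isomorphism `M → N` of `Λ`-modules induces
  `K ⊗_A M ≅ K ⊗_A N`**, so `dim_K (K ⊗_A M) = dim_K (K ⊗_A N)` (`finrank_baseChange_eq_of_isPseudoIsomorphism`). These are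
  the `𝒪`-coefficient twins of the tree's `ℤ_p`-statements `IwasawaAlgebra.ringKrullDim_eq_two`,
  `height_le_one_of_C_p_notMem`, `exists_C_p_pow_smul_eq_zero_of_isPseudoNull` (`Literature/…/IwasawaAlgebra.lean`), with
  the same proofs.

References: [Washington1997] §13.2 (Thm. 13.12 and the remark on `𝒪` in place of `ℤ_p`); [BourbakiAC5to7] VII §4.4–4.5;
[SkinnerUrban2014] §3.1.6; [BurungaleTian2026] Thm. 2.6 (the consumer).
-/

set_option autoImplicit false
-- the Theorems namespace of this sub repeats the summit name by design (D-0017 nested layout)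
set_option linter.dupNamespace false

noncomputable section

open scoped TensorProduct

namespace Summit.BirchSwinnertonDyer.BirchSwinnertonDyer.Theorems.CharIdealLambda

open Literature.NumberTheory.EllipticCurves

universe u v w

/-! ## §1 Characteristic ideals up to constants ⇒ equal height-one lengths off the constants -/

section UFD

variable {R : Type u} [CommRing R]
variable {M : Type v} [AddCommGroup M] [Module R M]
variable {N : Type w} [AddCommGroup N] [Module R N]

/-- `R/(c)` is a torsion `R`-module for `c ≠ 0` in a domain. [folklore] -/
theorem isTorsion_quotient_span_singleton [IsDomain R] {c : R} (hc : c ≠ 0) :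
    Module.IsTorsion R (R ⧸ Ideal.span {c}) := by
  intro q
  refine ⟨⟨c, mem_nonZeroDivisors_of_ne_zero hc⟩, ?_⟩
  obtain ⟨r, rfl⟩ := Ideal.Quotient.mk_surjective q
  change c • Ideal.Quotient.mk (Ideal.span {c}) r = 0
  rw [← Ideal.Quotient.mk_eq_mk, ← Submodule.Quotient.mk_smul, Submodule.Quotient.mk_eq_zero, smul_eq_mul]
  exact Ideal.mem_span_singleton.mpr (dvd_mul_right c r)

/-- `M × R/(c)` is torsion when `M` is and `c ≠ 0`. [folklore] -/
theorem isTorsion_prod_quotient_span_singleton [IsDomain R] (hM : Module.IsTorsion R M) {c : R} (hc : c ≠ 0) :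
    Module.IsTorsion R (M × (R ⧸ Ideal.span {c})) := by
  rintro ⟨m, q⟩
  obtain ⟨a, ha⟩ := @hM m
  have hT := isTorsion_quotient_span_singleton (R := R) hc
  obtain ⟨b, hb⟩ := @hT q
  refine ⟨a * b, ?_⟩
  change ((a : R) * b) • (m, q) = 0
  rw [Prod.smul_mk, Prod.mk_eq_zero, mul_comm, mul_smul, mul_comm, mul_smul]
  exact ⟨by rw [show (a : R) • m = 0 from ha, smul_zero], by rw [show (b : R) • q = 0 from hb, smul_zero]⟩

variable [IsNoetherianRing R] [IsDomain R] [UniqueFactorizationMonoid R] [Module.Finite R M] [Module.Finite R N]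

/-- **`char(M × R/(c)) = char(M)·(c)`** for a finitely generated torsion module `M` over a Noetherian UFD and `c ≠ 0`
(multiplicativity of characteristic ideals in `0 → M → M × R/(c) → R/(c) → 0`, and `char(R/(c)) = (c)`).
[cite: BourbakiAC5to7, Ch. VII §4 no. 5] [cite: Washington1997, §13.2] -/
theorem charIdeal_prod_quotient_span_singleton (hM : Module.IsTorsion R M) {c : R} (hc : c ≠ 0) :
    Module.charIdeal R (M × (R ⧸ Ideal.span {c})) = Module.charIdeal R M * Ideal.span {c} := by
  rw [Module.charIdeal_eq_mul_of_exact (isTorsion_prod_quotient_span_singleton hM hc)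
      (LinearMap.inl R M (R ⧸ Ideal.span {c})) (LinearMap.snd R M (R ⧸ Ideal.span {c})) LinearMap.inl_injective
      LinearMap.snd_surjective Function.Exact.inl_snd,
    Module.charIdeal_quotient_span_singleton hc]

/-- **A1 `LengthEqOffConstants` (STUB-PLAN rev 3 §3 Step 1): a characteristic-ideal identity UP TO NON-ZERO CONSTANTS
determines the local lengths at every height-one prime avoiding the constants.** For finitely generated torsion modules
`M, N` over a Noetherian UFD `R` and `c, d ≠ 0` with `(c)·char(M) = (d)·char(N)`: `ℓ_𝔭(M) = ℓ_𝔭(N)` at every height-one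
prime `𝔭` with `c, d ∉ 𝔭`. (Over `Λ_𝒪 = 𝒪⟦T⟧` with `c, d ∈ 𝒪 ∖ 0` constants: at every height-one `𝔭 ≠ (ϖ)` — the currency
of `Kato2004.ZetaQuotientPackage.CharIdealEqUpToConst`, i.e. of Burungale–Tian 2026 Thm. 2.6 as typed.)
[cite: SkinnerUrban2014, §3.1.6 (p. 20)] [cite: Washington1997, §13.2] [cite: BurungaleTian2026, Thm. 2.6 (p. 5)] -/
theorem lengthAt_eq_of_span_singleton_mul_charIdeal_eq (hM : Module.IsTorsion R M) (hN : Module.IsTorsion R N)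
    {c d : R} (hc : c ≠ 0) (hd : d ≠ 0)
    (h : Ideal.span {c} * Module.charIdeal R M = Ideal.span {d} * Module.charIdeal R N)
    (𝔭 : PrimeSpectrum R) (h𝔭 : 𝔭.asIdeal.height = 1) (hc𝔭 : c ∉ 𝔭.asIdeal) (hd𝔭 : d ∉ 𝔭.asIdeal) :
    Module.lengthAt R M 𝔭 = Module.lengthAt R N 𝔭 := by
  have h' : Module.charIdeal R (M × (R ⧸ Ideal.span {c})) = Module.charIdeal R (N × (R ⧸ Ideal.span {d})) := by
    rw [charIdeal_prod_quotient_span_singleton hM hc, charIdeal_prod_quotient_span_singleton hN hd, mul_comm, h,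
      mul_comm]
  have key := SkinnerUrban2014.lengthAt_eq_of_charIdeal_eq (isTorsion_prod_quotient_span_singleton hM hc)
    (isTorsion_prod_quotient_span_singleton hN hd) h' 𝔭 h𝔭
  rwa [Module.lengthAt_prod, Module.lengthAt_prod,
    Module.lengthAt_quotient_eq_zero_of_not_le (fun hle ↦ hc𝔭 (hle (Ideal.mem_span_singleton_self c))),
    Module.lengthAt_quotient_eq_zero_of_not_le (fun hle ↦ hd𝔭 (hle (Ideal.mem_span_singleton_self d))),
    add_zero, add_zero] at key

/-- **One-sided A1: `(c)·char(M) ⊆ (d)·char(N)` forces `ℓ_𝔭(N) ≤ ℓ_𝔭(M)`** at every height-one `𝔭 ∌ c, d` (the shape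
of a DIVISIBILITY "main conjecture up to constants": `char(N) ∣ char(M)` off the constants).
[cite: SkinnerUrban2014, §3.1.6 (p. 20)] [cite: Washington1997, §13.2] -/
theorem lengthAt_le_of_span_singleton_mul_charIdeal_le (hM : Module.IsTorsion R M) (hN : Module.IsTorsion R N)
    {c d : R} (hc : c ≠ 0) (hd : d ≠ 0)
    (h : Ideal.span {c} * Module.charIdeal R M ≤ Ideal.span {d} * Module.charIdeal R N)
    (𝔭 : PrimeSpectrum R) (h𝔭 : 𝔭.asIdeal.height = 1) (hc𝔭 : c ∉ 𝔭.asIdeal) (hd𝔭 : d ∉ 𝔭.asIdeal) :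
    Module.lengthAt R N 𝔭 ≤ Module.lengthAt R M 𝔭 := by
  have h' : Module.charIdeal R (M × (R ⧸ Ideal.span {c})) ≤ Module.charIdeal R (N × (R ⧸ Ideal.span {d})) := by
    rw [charIdeal_prod_quotient_span_singleton hM hc, charIdeal_prod_quotient_span_singleton hN hd, mul_comm,
      mul_comm (Module.charIdeal R N)]
    exact h
  have key := SkinnerUrban2014.lengthAt_le_of_charIdeal_le (isTorsion_prod_quotient_span_singleton hM hc)
    (isTorsion_prod_quotient_span_singleton hN hd) h' 𝔭 h𝔭
  rwa [Module.lengthAt_prod, Module.lengthAt_prod,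
    Module.lengthAt_quotient_eq_zero_of_not_le (fun hle ↦ hc𝔭 (hle (Ideal.mem_span_singleton_self c))),
    Module.lengthAt_quotient_eq_zero_of_not_le (fun hle ↦ hd𝔭 (hle (Ideal.mem_span_singleton_self d))),
    add_zero, add_zero] at key

end UFD

/-! ## §2 `Λ = A⟦X⟧` over a discrete valuation ring: dimension two, pseudo-null = `ϖ`-power torsion -/

section DVR

variable {A : Type u} [CommRing A] [IsDomain A] [IsDiscreteValuationRing A]

/-- A constant `C a` with `a ∈ 𝔪_A` lies in the maximal ideal of the local ring `A⟦X⟧`. [folklore] -/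
theorem C_mem_maximalIdeal_of_mem {a : A} (ha : a ∈ IsLocalRing.maximalIdeal A) :
    (PowerSeries.C a : PowerSeries A) ∈ IsLocalRing.maximalIdeal (PowerSeries A) := by
  rw [IsLocalRing.mem_maximalIdeal, mem_nonunits_iff, PowerSeries.isUnit_iff_constantCoeff, PowerSeries.constantCoeff_C]
  exact (IsLocalRing.mem_maximalIdeal _).mp ha

/-- **`dim A⟦X⟧ = 2` for a discrete valuation ring `A`** (`dim A⟦X⟧/(X) + 1 = dim A + 1`; Washington §13.2 for
`A = ℤ_p`, remark on `𝒪`). [cite: Washington1997, §13.2] -/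
theorem ringKrullDim_powerSeries_eq_two : ringKrullDim (PowerSeries A) = 2 := by
  have hX : (PowerSeries.X : PowerSeries A) ∈ IsLocalRing.maximalIdeal (PowerSeries A) := by
    rw [IsLocalRing.mem_maximalIdeal, mem_nonunits_iff, PowerSeries.isUnit_iff_constantCoeff]
    simp
  have h := ringKrullDim_quotient_span_singleton_succ_eq_ringKrullDim_of_mem_nonZeroDivisors
    (mem_nonZeroDivisors_of_ne_zero (PowerSeries.X_ne_zero (R := A))) hX
  let e : (PowerSeries A ⧸ Ideal.span {(PowerSeries.X : PowerSeries A)}) ≃+* A :=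
    (Ideal.quotEquivOfEq (by
      ext f
      rw [RingHom.mem_ker, Ideal.mem_span_singleton, PowerSeries.X_dvd_iff])).trans
      (RingHom.quotientKerEquivOfSurjective (PowerSeries.constantCoeff_surj (R := A)))
  rw [ringKrullDim_eq_of_ringEquiv e,
    IsPrincipalIdealRing.ringKrullDim_eq_one _ (IsDiscreteValuationRing.not_isField A)] at h
  rw [← h]
  rfl

/-- A prime of `A⟦X⟧` avoiding the constant `C a`, `a ∈ 𝔪_A`, has height `≤ 1` (it lies strictly below
`𝔪 = (ϖ, X)` of height `dim A⟦X⟧ = 2`). [cite: Washington1997, §13.2] -/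
theorem height_le_one_of_C_notMem {a : A} (ha : a ∈ IsLocalRing.maximalIdeal A) (𝔮 : Ideal (PowerSeries A))
    [𝔮.IsPrime] (h𝔮 : (PowerSeries.C a : PowerSeries A) ∉ 𝔮) : 𝔮.height ≤ 1 := by
  have hlt : 𝔮 < IsLocalRing.maximalIdeal (PowerSeries A) :=
    lt_of_le_of_ne (IsLocalRing.le_maximalIdeal Ideal.IsPrime.ne_top') (fun h ↦ h𝔮 (h ▸ C_mem_maximalIdeal_of_mem ha))
  have h1 := Ideal.height_add_one_le_of_lt_of_isPrime hlt
  have h2 : ((IsLocalRing.maximalIdeal (PowerSeries A)).height : WithBot ℕ∞) ≤ 2 :=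
    ringKrullDim_powerSeries_eq_two (A := A) ▸ Ideal.height_le_ringKrullDim_of_isPrime
  have h3 : (IsLocalRing.maximalIdeal (PowerSeries A)).height ≤ 2 := by
    rw [show (2 : WithBot ℕ∞) = ((2 : ℕ∞) : WithBot ℕ∞) from rfl] at h2
    exact WithBot.coe_le_coe.1 h2
  have h4 : 𝔮.height + 1 ≤ 1 + 1 := h1.trans h3
  exact (WithTop.add_le_add_iff_right WithTop.one_ne_top).1 h4

/-- **Every element of a pseudo-null `A⟦X⟧`-module is killed by a power of `C a`**, for any `a ∈ 𝔪_A` (e.g. the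
uniformiser `ϖ`): the annihilator of the element lies in no prime of height `≤ 1`, hence in no prime avoiding `C a`, so
`C a` is in its radical. (For finitely generated modules: "pseudo-null = finite length", Washington §13.2.)
[cite: Washington1997, §13.2] [cite: BourbakiAC5to7, Ch. VII §4 no. 4] -/
theorem exists_C_pow_smul_eq_zero_of_isPseudoNull {a : A} (ha : a ∈ IsLocalRing.maximalIdeal A) {P : Type v}
    [AddCommGroup P] [Module (PowerSeries A) P] (hP : Module.IsPseudoNull (PowerSeries A) P) (z : P) :
    ∃ n : ℕ, (PowerSeries.C a : PowerSeries A) ^ n • z = 0 := by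
  by_contra! H
  set J : Ideal (PowerSeries A) := Ideal.torsionOf (PowerSeries A) P z
  have hrad : (PowerSeries.C a : PowerSeries A) ∉ J.radical := by
    rintro ⟨n, hn⟩
    exact H n ((Ideal.mem_torsionOf_iff z _).1 hn)
  rw [Ideal.radical_eq_sInf, Submodule.mem_sInf] at hrad
  push Not at hrad
  obtain ⟨𝔮, ⟨hJ𝔮, h𝔮⟩, hp𝔮⟩ := hrad
  haveI := h𝔮
  have hht := height_le_one_of_C_notMem ha 𝔮 hp𝔮
  have hsub : Subsingleton (LocalizedModule (Ideal.primeCompl 𝔮) P) := hP ⟨𝔮, h𝔮⟩ hht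
  have hz : (LocalizedModule.mk z 1 : LocalizedModule (Ideal.primeCompl 𝔮) P) = LocalizedModule.mk 0 1 :=
    Subsingleton.elim _ _
  rw [LocalizedModule.mk_eq] at hz
  obtain ⟨u, hu⟩ := hz
  simp only [one_smul, smul_zero] at hu
  have hu' : (u : PowerSeries A) ∈ J := (Ideal.mem_torsionOf_iff z _).2 hu
  exact u.2 (hJ𝔮 hu')

omit [IsDomain A] [IsDiscreteValuationRing A] in
/-- The `A`-action of `aⁿ` on a `A⟦X⟧`-module (along the scalar tower) is the `A⟦X⟧`-action of `(C a)ⁿ`. [folklore] -/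
theorem pow_smul_eq_C_pow_smul {P : Type v} [AddCommGroup P] [Module (PowerSeries A) P] [Module A P]
    [IsScalarTower A (PowerSeries A) P] (a : A) (n : ℕ) (y : P) :
    a ^ n • y = (PowerSeries.C a : PowerSeries A) ^ n • y := by
  rw [← algebraMap_smul (PowerSeries A), map_pow, ← PowerSeries.C_eq_algebraMap]

variable (K : Type w) [CommRing K] [Algebra A K] [Module.Flat A K]

/-- **A pseudo-isomorphism of `A⟦X⟧`-modules becomes an isomorphism after `K ⊗_A ·`** for any flat `A`-algebra `K` in
which the uniformiser is invertible (e.g. `K = Frac A`): kernel and cokernel are pseudo-null, hence `ϖ`-power torsion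
(`exists_C_pow_smul_eq_zero_of_isPseudoNull`), hence die in `K ⊗_A ·` (`Module.bijective_baseChange_of_pow_smul`).
[cite: Washington1997, §13.2] [cite: BourbakiAC5to7, Ch. VII §4 no. 4] -/
theorem bijective_baseChange_of_isPseudoIsomorphism {ϖ : A} (hϖ : ϖ ∈ IsLocalRing.maximalIdeal A)
    (hϖK : IsUnit (algebraMap A K ϖ)) {P : Type v} {Q : Type v} [AddCommGroup P] [Module (PowerSeries A) P]
    [Module A P] [IsScalarTower A (PowerSeries A) P] [AddCommGroup Q] [Module (PowerSeries A) Q] [Module A Q]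
    [IsScalarTower A (PowerSeries A) Q] (f : P →ₗ[PowerSeries A] Q) (hf : LinearMap.IsPseudoIsomorphism f) :
    Function.Bijective ((f.restrictScalars A).baseChange K) := by
  refine Module.bijective_baseChange_of_pow_smul K hϖK (f.restrictScalars A) (fun x hx ↦ ?_) (fun y ↦ ?_)
  · obtain ⟨n, hn⟩ := exists_C_pow_smul_eq_zero_of_isPseudoNull hϖ hf.1 ⟨x, hx⟩
    refine ⟨n, ?_⟩
    have hn' := congrArg Subtype.val hn
    simp only [SetLike.val_smul, ZeroMemClass.coe_zero] at hn'
    rwa [pow_smul_eq_C_pow_smul]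
  · obtain ⟨n, hn⟩ := exists_C_pow_smul_eq_zero_of_isPseudoNull hϖ hf.2 (Submodule.Quotient.mk y)
    rw [← Submodule.Quotient.mk_smul, Submodule.Quotient.mk_eq_zero, LinearMap.mem_range] at hn
    obtain ⟨x, hx⟩ := hn
    exact ⟨n, x, by rw [LinearMap.restrictScalars_apply, hx, pow_smul_eq_C_pow_smul]⟩

/-- **`dim_K (K ⊗_A P) = dim_K (K ⊗_A Q)` for pseudo-isomorphic `A⟦X⟧`-modules** (`K` flat over `A` with `ϖ`
invertible, e.g. `K = Frac A`): the λ-invariant is a pseudo-isomorphism invariant (Washington §13.2, remark on `𝒪`).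
[cite: Washington1997, §13.2] -/
theorem finrank_baseChange_eq_of_isPseudoIsomorphism {ϖ : A} (hϖ : ϖ ∈ IsLocalRing.maximalIdeal A)
    (hϖK : IsUnit (algebraMap A K ϖ)) {P : Type v} {Q : Type v} [AddCommGroup P] [Module (PowerSeries A) P]
    [Module A P] [IsScalarTower A (PowerSeries A) P] [AddCommGroup Q] [Module (PowerSeries A) Q] [Module A Q]
    [IsScalarTower A (PowerSeries A) Q] (f : P →ₗ[PowerSeries A] Q) (hf : LinearMap.IsPseudoIsomorphism f) :
    Module.finrank K (K ⊗[A] P) = Module.finrank K (K ⊗[A] Q) :=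
  (LinearEquiv.ofBijective _ (bijective_baseChange_of_isPseudoIsomorphism K hϖ hϖK f hf)).finrank_eq

end DVR

end Summit.BirchSwinnertonDyer.BirchSwinnertonDyer.Theorems.CharIdealLambda

end
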